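import Summits.AnomalousDissipation.AnomalousDissipation.Theorems.SolenoidalFractalHomogenisationLagrangianStepCellChainFastSlaving
import Summits.AnomalousDissipation.AnomalousDissipation.Theorems.SolenoidalFractalHomogenisationLagrangianStepCellChainEnergy
import Summits.AnomalousDissipation.AnomalousDissipation.Theorems.SolenoidalFractalHomogenisationLagrangianStepCellChainSlotStepInputs
import HarnessLib

/-!
# K1L_D `LagrangianRenormalisationStepDesign` (stmt-AnomalousDissipation-27980), `stub_D1_V0` (V0 = clause (ii) of
# `WCrossing.D1ExactFamily`), brick T4 final (tail integral): THE TIME-INTEGRATED ENERGY OF A FINITE SET OF HIGH MODES OF THE WEAK SOLUTION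
# IS `≤ ‖F‖²/(8π²·lo'·κ)` (helper; `--kind proof --supports stmt-AnomalousDissipation-27980 --as helper`)

Summits-side helper file of route `SolenoidalFractalHomogenisation` (prover seat `ad-k1l-cellLawV-w1` g6).  Everything proved; no definitions, no named
facts, no sorry.  The truncation tail of the V0 residual estimate (`…SidebandXTail`, memo `Cruxes/LagrangianRenormalisationStepDesign/Lines/onelevel-V0-residual.md`
§3 D4) leaves, after pairing against the dissipation weight, the time integral of the energy of finitely many class modes OUTSIDE the box, all of
frequency `|k|² ≥ κ ≈ n²(R − max|mⱼ|)²`.  From the energy package of THE weak solution (`CellChain.exists_energyRep_cell`: `E t = ‖F‖² − 2∫₀ᵗQ`,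
`E ≥ 0`, `4π²Σ_S Re⟪û,T_𝔹 û⟫ ≤ Q` a.e., `lo'|k|²‖û_k‖² ≤ Re⟪û_k,T_𝔹û_k⟫`):
* `intervalIntegral_Q_le` — `∫₀ᵀ Q ≤ ‖F‖²/2`;
* **`integral_sum_norm_sq_modeRep_le`** — for a finite `S` with `κ ≤ |k|²` on `S` (`κ > 0`):
  `∫_{(0,T)} Σ_{k∈S} ‖modeRep k t‖² dt ≤ ‖F‖²/(8π²·lo'·κ)`.
NOT a proof of any registered stub, of K1L_D, or of anomalous dissipation; rung F-D1.A0 infrastructure.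
-/

set_option linter.dupNamespace false

noncomputable section

namespace Summit.AnomalousDissipation.AnomalousDissipation.Theorems.SolenoidalFractalHomogenisation.LagrangianStep.CellChain

open Set MeasureTheory Complex UnitAddTorus Filter Topology
open scoped InnerProductSpace
open Literature.Analysis Literature.Analysis.FunctionSpaces Literature.Analysis.FunctionSpaces.Torus
open Literature.Analysis.FluidPDE Literature.Analysis.FluidPDE.Torus Literature.Analysis.FluidPDE.LatticeShear

variable {k₀ : ℕ}

/-- **Time-integrated energy of a finite set of high modes**: for `S` finite with `κ ≤ |k|²` on `S`,
`∫_{(0,T)} Σ_{k∈S} ‖modeRep k t‖² ≤ ‖F‖²/(8π²·lo'·κ)`. [cite: Temam1984, Ch. III §1 Lemma 1.2 (energy inequality)] -/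
theorem integral_sum_norm_sq_modeRep_le (W₁ : LatticeWord k₀) (n : ℕ) {T : ℝ} (hT : 0 < T) {𝔹 : Torus.Visc4 (Fin 3)} {lo' hi' : ℝ}
    (h𝔹 : Torus.NearIso 𝔹 lo' hi') (hlo' : 0 < lo')
    {F : UnitAddTorus (Fin 3) → EuclideanSpace ℝ (Fin 3)} {u : ℝ → UnitAddTorus (Fin 3) → EuclideanSpace ℝ (Fin 3)}
    (hF : MemLp F 2 volume) (hFdiv : FunctionSpaces.Torus.IsWeaklyDivFree F) (hFi : Integrable F volume)
    (h : Torus.IsWeakTensorPassiveVectorOn 0 T 𝔹 (W₁.cell n) F u) (S : Finset (Fin 3 → ℤ)) {κ : ℝ} (hκ : 0 < κ)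
    (hS : ∀ k ∈ S, κ ≤ freqNormSq k) :
    ∫ t in Ioo 0 T, ∑ k ∈ S, ‖modeRep W₁ n 𝔹 F u k t‖ ^ 2 ≤ (∫ x, ‖F x‖ ^ 2) / (8 * Real.pi ^ 2 * lo' * κ) := by
  obtain ⟨E, Q, hE0, hEQ, hEc, _, _, hEae, hQint, hQnn, _, hQdom, hterm⟩ := exists_energyRep_cell W₁ n hT h𝔹 hlo' hF hFdiv h
  have hπ : 0 < 8 * Real.pi ^ 2 * lo' * κ := by positivity
  -- (1) `∫₀ᵀ Q ≤ ‖F‖²/2` from `E T ≥ 0`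
  have hET : 0 ≤ E T := by
    have hc0 : ContinuousOn (fun _ : ℝ => (0:ℝ)) (Icc 0 T) := continuousOn_const
    have hae : ∀ᵐ t ∂(volume.restrict (Ioo 0 T)), (0:ℝ) ≤ E t := by
      filter_upwards [hEae] with t ht
      rw [ht]; positivity
    exact le_on_Icc_of_ae_le hT hc0 hEc hae T ⟨hT.le, le_rfl⟩
  have hQT : ∫ s in (0:ℝ)..T, Q s ≤ (∫ x, ‖F x‖ ^ 2) / 2 := by
    have := hEQ T ⟨hT.le, le_rfl⟩
    linarith
  have hQT' : ∫ s in Ioo 0 T, Q s ≤ (∫ x, ‖F x‖ ^ 2) / 2 := by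
    rw [← integral_Ioc_eq_integral_Ioo, ← intervalIntegral.integral_of_le hT.le]
    exact hQT
  -- (2) a.e. pointwise: `Σ_S ‖modeRep k t‖² ≤ Q t/(4π² lo' κ)`
  have hpt : ∀ᵐ t ∂(volume.restrict (Ioo 0 T)), ∑ k ∈ S, ‖modeRep W₁ n 𝔹 F u k t‖ ^ 2 ≤ Q t / (4 * Real.pi ^ 2 * lo' * κ) := by
    filter_upwards [ae_forall_eq_modeRep W₁ n hT.le h hFi, hQdom, hterm] with t hrep hQ hk
    have hQS := hQ S
    have hsum : 4 * Real.pi ^ 2 * lo' * κ * ∑ k ∈ S, ‖modeRep W₁ n 𝔹 F u k t‖ ^ 2 ≤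
        4 * Real.pi ^ 2 * ∑ k ∈ S, (⟪mFourierCoeff (EuclideanSpace.complexify ∘ u t) k,
          Torus.symbT 𝔹 k (mFourierCoeff (EuclideanSpace.complexify ∘ u t) k)⟫_ℂ).re := by
      rw [mul_assoc (4 * Real.pi ^ 2), mul_assoc (4 * Real.pi ^ 2), Finset.mul_sum]
      refine mul_le_mul_of_nonneg_left (Finset.sum_le_sum fun k hkS => ?_) (by positivity)
      have h1 := (hk k).2
      rw [← hrep k]
      have h2 : lo' * κ * ‖mFourierCoeff (EuclideanSpace.complexify ∘ u t) k‖ ^ 2 ≤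
          lo' * (freqNormSq k * ‖mFourierCoeff (EuclideanSpace.complexify ∘ u t) k‖ ^ 2) := by
        rw [mul_assoc]; exact mul_le_mul_of_nonneg_left (mul_le_mul_of_nonneg_right (hS k hkS) (sq_nonneg _)) hlo'.le
      exact h2.trans h1
    rw [le_div_iff₀ (by positivity)]
    linarith
  -- (3) integrate
  have hcont : ContinuousOn (fun t => ∑ k ∈ S, ‖modeRep W₁ n 𝔹 F u k t‖ ^ 2) (Icc 0 T) :=
    continuousOn_finsetSum S fun k _ => ((continuousOn_modeRep W₁ n hT.le h k).norm).pow 2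
  have hintL : IntegrableOn (fun t => ∑ k ∈ S, ‖modeRep W₁ n 𝔹 F u k t‖ ^ 2) (Ioo 0 T) volume :=
    (hcont.integrableOn_Icc).mono_set Ioo_subset_Icc_self
  have hintR : IntegrableOn (fun t => Q t / (4 * Real.pi ^ 2 * lo' * κ)) (Ioo 0 T) volume := hQint.div_const _
  calc ∫ t in Ioo 0 T, ∑ k ∈ S, ‖modeRep W₁ n 𝔹 F u k t‖ ^ 2
      ≤ ∫ t in Ioo 0 T, Q t / (4 * Real.pi ^ 2 * lo' * κ) := setIntegral_mono_ae_restrict hintL hintR hpt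
    _ = (∫ t in Ioo 0 T, Q t) / (4 * Real.pi ^ 2 * lo' * κ) := by rw [integral_div]
    _ ≤ ((∫ x, ‖F x‖ ^ 2) / 2) / (4 * Real.pi ^ 2 * lo' * κ) := by gcongr
    _ = (∫ x, ‖F x‖ ^ 2) / (8 * Real.pi ^ 2 * lo' * κ) := by field_simp; ring

end Summit.AnomalousDissipation.AnomalousDissipation.Theorems.SolenoidalFractalHomogenisation.LagrangianStep.CellChain

end
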